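import Mathlib
import Summits.Ventures.DiscreteObjects.Mahler.CensusSearchPacked

/-!
# The census search with packed internal levels (venture `DiscreteObjects`, target L)

Cell `pub-namedobj`, seat `pub-namedobj-mahler-g20` (pipeline of seats g12–g19). Framing: lottery ticket; floor = certified
bounds/negative ranges.

`censusSearchQ` is `censusSearchP` (`CensusSearchPacked`: packed accumulators, packed leaf loop, in-kernel junk drop) whose INTERNAL
levels are packed too: at a node of depth `n` the Newton sum `Σ c_i P_{n+1-i}` is read from slot `n+1` of `Cacc·Sacc` and every cut
row `(λ, rest, N)` is evaluated as `N + ⟨rest, ps⟩` with `⟨rest, ps⟩` read from slot `n+1` of `packFrom 1 rest · Sacc` (the rows are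
pre-packed: table `QT`), both DECODED to integers by `decZ` — exact because the search checks at run time that every chosen coefficient is
`≤ 2^10` and every power sum `≤ 2^20` in absolute value (`decZ_dot`), falling back to the list search `censusSearchC` otherwise (never, in
practice).  TRANSFER (`mem_censusSearchQ_or_junk`, `forall_certX_of_allCertifiedQs`): as for `censusSearchP`, with the same conclusion
shape, so the census verdict `degreeCensus_of_certified_nonnegXC` applies unchanged.  Infrastructure only; no census row is claimed here.
-/

namespace Summit.Ventures.DiscreteObjects.Mahler

open Polynomial

/-! ## Decoding a slot -/

/-- The signed value of a residue `m < W` (two's complement). -/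
def decZ (m : ℕ) : ℤ := if m < 9223372036854775808 then (m : ℤ) else (m : ℤ) - 18446744073709551616

/-- Decoding is exact for values below `2^63` in absolute value. -/
theorem decZ_eq_of_cast (m : ℕ) (v : ℤ) (hm : m < pW) (hv : v.natAbs < 2 ^ 62)
    (h : ((m : ℕ) : ZMod pW) = ((v : ℤ) : ZMod pW)) : decZ m = v := by
  rw [← Int.cast_natCast, ZMod.intCast_eq_intCast_iff, Int.modEq_iff_dvd] at h
  obtain ⟨q, hq⟩ := h
  unfold pW at hm hq
  push_cast at hq
  unfold decZ
  split_ifs with hlt <;> omega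

/-- A dot product of bounded lists is bounded. -/
theorem natAbs_sum_zipWith_le (A B : ℕ) : ∀ (xs ps : List ℤ), (∀ x ∈ xs, x.natAbs ≤ A) → (∀ p ∈ ps, p.natAbs ≤ B) →
    ((List.zipWith (· * ·) xs ps).sum).natAbs ≤ xs.length * (A * B) := by
  intro xs
  induction xs with
  | nil => intro ps _ _; simp
  | cons x xs ih =>
    intro ps hx hp
    cases ps with
    | nil => simp
    | cons p ps =>
      rw [List.zipWith_cons_cons, List.sum_cons, List.length_cons]
      have h1 : (x * p).natAbs ≤ A * B := by
        rw [Int.natAbs_mul]; exact Nat.mul_le_mul (hx x (by simp)) (hp p (by simp))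
      have h2 := ih ps (fun y hy => hx y (by simp [hy])) (fun q hq => hp q (by simp [hq]))
      calc _ ≤ (x * p).natAbs + ((List.zipWith (· * ·) xs ps).sum).natAbs := Int.natAbs_add_le _ _
        _ ≤ A * B + xs.length * (A * B) := Nat.add_le_add h1 h2
        _ = (xs.length + 1) * (A * B) := by ring

/-- **Packed dot product.** Slot `n+1` of `packFrom 1 xs · packS ps`, decoded, is `⟨xs, ps⟩` (`|xs| ≤ n = |ps| ≤ 61`, entries of `xs`
at most `2^10`, of `ps` at most `2^20` in absolute value). -/
theorem decZ_dot (xs ps : List ℤ) (hn : xs.length ≤ ps.length) (hl : ps.length ≤ 61) (hx : ∀ x ∈ xs, x.natAbs ≤ 2 ^ 10)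
    (hp : ∀ p ∈ ps, p.natAbs ≤ 2 ^ 20) :
    decZ (packFrom 1 xs * packS ps / pG ^ (ps.length + 1) % pW) = (List.zipWith (· * ·) xs ps).sum := by
  have hD : (dPoly xs (xs.length + 1)).eval pG = 0 := by
    rw [eval_dPoly _ _ (by omega), Nat.add_sub_cancel, List.drop_length]; rfl
  have hZ : packFrom 1 xs * packS ps = (cPoly xs * sPoly (sigma0 ps) (ps.length + 1) + dPoly xs (xs.length + 1)).eval pG := by
    rw [eval_add, eval_mul, eval_cPoly, ← packS_eq_eval, hD, add_zero]
  apply decZ_eq_of_cast _ _ (Nat.mod_lt _ pW_pos)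
  · have := natAbs_sum_zipWith_le (2 ^ 10) (2 ^ 20) xs ps hx hp
    have h2 : xs.length * (2 ^ 10 * 2 ^ 20) ≤ 61 * (2 ^ 10 * 2 ^ 20) := Nat.mul_le_mul_right _ (by omega)
    omega
  · rw [hZ, eval_div_pow_mod _ _ (fun m hm => coeff_ghost_lt _ _ _ _ m (sigma0_lt ps) (by omega)), ZMod.natCast_mod,
      coeff_ghost_k xs ps (sigma0 ps) (ps.length + 1) (xs.length + 1) rfl rfl (fun i hi => sigma0_cast ps i hi) (by omega),
      newtonNext, List.getD_eq_getElem?_getD, List.getElem?_eq_none_iff.mpr hn, Option.getD_none]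
    push_cast
    ring

/-! ## Cut rows evaluated on packed power sums -/

/-- `cutBounds` with every row value `N + ⟨rest, ps⟩` read from the packed power sums (`rp = packFrom 1 rest`). -/
def cutBoundsQ : List (ℤ × ℕ × ℤ) → ℕ → ℕ → ℤ → ℤ → ℤ × ℤ
  | [], _, _, lb, ub => (lb, ub)
  | (lk, rp, N) :: cs, S, g, lb, ub =>
    let v := N + decZ (rp * S / g % pW)
    if 0 < lk then cutBoundsQ cs S g (max lb (-(v / lk))) ub
    else if lk < 0 then cutBoundsQ cs S g lb (min ub (v / (-lk)))
    else cutBoundsQ cs S g lb ub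

/-- A row packed for `cutBoundsQ`. -/
def packRow (c : List ℤ × ℤ) : ℤ × ℕ × ℤ := (c.1.headD 0, packFrom 1 c.1.tail, c.2)

/-- `cutBoundsQ` on packed rows computes `cutBounds` (rows of length `≤ n+1` with entries `≤ 2^10`; power sums `≤ 2^20`). -/
theorem cutBoundsQ_eq (ps : List ℤ) (hl : ps.length ≤ 61) (hp : ∀ p ∈ ps, p.natAbs ≤ 2 ^ 20) :
    ∀ (rows : List (List ℤ × ℤ)) (lb ub : ℤ), (∀ c ∈ rows, c.1.length ≤ ps.length + 1 ∧ ∀ x ∈ c.1, x.natAbs ≤ 2 ^ 10) →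
      cutBoundsQ (rows.map packRow) (packS ps) (pG ^ (ps.length + 1)) lb ub = cutBounds rows ps lb ub := by
  intro rows
  induction rows with
  | nil => intro lb ub _; rfl
  | cons c cs ih =>
    intro lb ub hrows
    have hcs : ∀ c' ∈ cs, c'.1.length ≤ ps.length + 1 ∧ ∀ x ∈ c'.1, x.natAbs ≤ 2 ^ 10 := fun c' hc' => hrows c' (by simp [hc'])
    obtain ⟨hlen, hent⟩ := hrows c (by simp)
    obtain ⟨lams, N⟩ := c
    cases lams with
    | nil =>
      rw [List.map_cons, packRow, cutBounds]
      simp only [List.headD_nil, List.tail_nil, lt_irrefl, if_false, cutBoundsQ]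
      exact ih lb ub hcs
    | cons lk rest =>
      rw [List.map_cons, packRow, cutBounds]
      simp only [List.headD_cons, List.tail_cons, cutBoundsQ]
      have hdot : decZ (packFrom 1 rest * packS ps / pG ^ (ps.length + 1) % pW) = (List.zipWith (· * ·) rest ps).sum :=
        decZ_dot rest ps (by simp at hlen; omega) hl (fun x hx => hent x (by simp [hx])) hp
      rw [hdot]
      split_ifs
      · exact ih _ _ hcs
      · exact ih _ _ hcs
      · exact ih _ _ hcs

/-! ## The search -/

/-- **The census search with packed internal levels** (`QT` = the cut table with packed rows; otherwise as `censusSearchP`; a child whose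
coefficient exceeds `2^10` or whose power sum exceeds `2^20` is handed to the list search `censusSearchC`). -/
def censusSearchQ (T : List ℕ) (CT : List (List (List ℤ × ℤ))) (QT : List (List (ℤ × ℕ × ℤ))) (d NJ : ℕ) :
    ℕ → List ℤ → List ℤ → ℕ → ℕ → ℕ → ℕ → List (List ℤ)
  | 0, pre, ps, _, _, _, _ => if leafPass (palC pre) (T.drop pre.length) ps then [pre] else []
  | fuel + 1, pre, ps, Sacc, Cacc, Hacc, Dacc =>
    let n := pre.length
    let g := pG ^ (n + 1)
    let R : ℤ := -decZ (Cacc * Sacc / g % pW)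
    let kz : ℤ := ((n + 1 : ℕ) : ℤ)
    let Tk : ℤ := ((T.getD n 0 : ℕ) : ℤ)
    let b := cutBoundsQ (QT.getD n []) Sacc g (-Tk) Tk
    let lo := -((b.2 - R) / kz)
    let hi := (R - b.1) / kz
    let m := 2 * d - (n + 1)
    if fuel = 0 then
      let h := pG ^ (2 * d)
      (icc lo hi).flatMap fun ak =>
        let cf := Cacc + enc ak * g + Hacc + h
        let Z := cf * (Sacc + enc (-(kz * ak) + R) * g) + (Dacc + enc ((2 * d : ℕ) : ℤ) * h)
        if leafLoopPJ cf (1 :: palC (pre ++ [ak])) (2 * d) NJ (T.drop (n + 1)) Z (g * pG) then [pre ++ [ak]] else []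
    else (icc lo hi).flatMap fun ak =>
      let P := -(kz * ak) + R
      if ak.natAbs ≤ 2 ^ 10 ∧ P.natAbs ≤ 2 ^ 20 then
        censusSearchQ T CT QT d NJ fuel (pre ++ [ak]) (P :: ps) (Sacc + enc P * g) (Cacc + enc ak * g) (Hacc + enc ak * pG ^ m)
          (Dacc + enc ((m : ℕ) * ak) * pG ^ m)
      else censusSearchC T CT fuel (pre ++ [ak]) (P :: ps)

/-- **The search from a node** (packed accumulators computed from the prefix `pre`). -/
def censusSearchQs (T : List ℕ) (CT : List (List (List ℤ × ℤ))) (QT : List (List (ℤ × ℕ × ℤ))) (d NJ fuel : ℕ) (pre : List ℤ) :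
    List (List ℤ) :=
  censusSearchQ T CT QT d NJ fuel pre (psumsRev pre pre.length) (packS (psumsRev pre pre.length)) (packFrom 1 pre)
    (packFrom (2 * d - pre.length) pre.reverse) (packFromD (2 * d - pre.length) pre.reverse)

/-- Well-formedness of the tables for the packed internal levels: packed rows agree with the rows, rows of depth `n` have length
`≤ n + 1` and entries `≤ 2^10`. -/
def QTablesOK (CT : List (List (List ℤ × ℤ))) (QT : List (List (ℤ × ℕ × ℤ))) (d : ℕ) : Prop :=
  ∀ n < d, QT.getD n [] = (CT.getD n []).map packRow ∧ ∀ c ∈ CT.getD n [], c.1.length ≤ n + 1 ∧ ∀ x ∈ c.1, x.natAbs ≤ 2 ^ 10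

/-! ## Transfer -/

/-- **Transfer**: every survivor of `censusSearchC` is a survivor of `censusSearchQ` (true accumulators, bounded prefix) or a junk leaf. -/
theorem mem_censusSearchQ_or_junk {T : List ℕ} {CT : List (List (List ℤ × ℤ))} {QT : List (List (ℤ × ℕ × ℤ))} {d NJ : ℕ}
    (hT : ∀ t ∈ T, t < 2 ^ 61) (hTl : T.length ≤ 62) (hdl : d ≤ 62) (hQT : QTablesOK CT QT d) :
    ∀ (fuel : ℕ) (pre ps a : List ℤ) (Sacc Cacc Hacc Dacc : ℕ), ps.length = pre.length →
      1 ≤ pre.length → pre.length + fuel = d → Sacc = packS ps → Cacc = packFrom 1 pre →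
      Hacc = packFrom (2 * d - pre.length) pre.reverse → Dacc = packFromD (2 * d - pre.length) pre.reverse →
      (∀ c ∈ pre, c.natAbs ≤ 2 ^ 10) → (∀ p ∈ ps, p.natAbs ≤ 2 ^ 20) →
      a ∈ censusSearchC T CT fuel pre ps →
        a ∈ censusSearchQ T CT QT d NJ fuel pre ps Sacc Cacc Hacc Dacc ∨ junkK (1 :: palC a) (2 * d) = true := by
  intro fuel
  induction fuel with
  | zero =>
    intro pre ps a Sacc Cacc Hacc Dacc _ _ _ _ _ _ _ _ _ ha
    left
    rw [censusSearchC] at ha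
    rw [censusSearchQ]
    exact ha
  | succ fuel ih =>
    intro pre ps a Sacc Cacc Hacc Dacc hlen h1 hd hS hC hH hD hbpre hbps ha
    rw [mem_censusSearchC_succ_iff] at ha
    obtain ⟨ak, hak, ha⟩ := ha
    rw [mem_icc] at hak
    obtain ⟨hlo, hhi⟩ := hak
    by_cases hj : junkK (1 :: palC a) (2 * d) = true
    · exact Or.inr hj
    left
    simp only [Bool.not_eq_true] at hj
    have hpl : ps.length ≤ 61 := by omega
    -- the packed Newton sum and the packed cut rows are the list ones
    have hR : -decZ (Cacc * Sacc / pG ^ (pre.length + 1) % pW) = -(List.zipWith (· * ·) pre ps).sum := by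
      rw [hC, hS, ← hlen, decZ_dot pre ps (by omega) hpl hbpre hbps]
    obtain ⟨hQTn, hrows⟩ := hQT pre.length (by omega)
    have hb : cutBoundsQ (QT.getD pre.length []) Sacc (pG ^ (pre.length + 1)) (-((T.getD pre.length 0 : ℕ) : ℤ))
        ((T.getD pre.length 0 : ℕ) : ℤ) = cutBounds (CT.getD pre.length []) ps (-((T.getD pre.length 0 : ℕ) : ℤ))
        ((T.getD pre.length 0 : ℕ) : ℤ) := by
      rw [hQTn, hS, ← hlen]
      exact cutBoundsQ_eq ps hpl hbps _ _ _ (by rw [hlen]; exact hrows)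
    have hlen' : (nodeP pre ps ak :: ps).length = (pre ++ [ak]).length := by simp [hlen]
    have h1' : 1 ≤ (pre ++ [ak]).length := by simp
    have hd' : (pre ++ [ak]).length + fuel = d := by simp; omega
    have hle : pre.length + 1 ≤ 2 * d := by omega
    have hS' : Sacc + enc (nodeP pre ps ak) * pG ^ (pre.length + 1) = packS (nodeP pre ps ak :: ps) := by
      rw [packS, hS, hlen, add_comm]
    have hC' : Cacc + enc ak * pG ^ (pre.length + 1) = packFrom 1 (pre ++ [ak]) := by
      rw [packFrom_append, hC, packFrom, packFrom, add_zero, add_comm 1 pre.length]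
    have hrev : (pre ++ [ak]).reverse = ak :: pre.reverse := by simp
    have hH' : Hacc + enc ak * pG ^ (2 * d - (pre.length + 1)) =
        packFrom (2 * d - (pre ++ [ak]).length) (pre ++ [ak]).reverse := by
      rw [hrev, List.length_append, List.length_singleton, packFrom, hH,
        show 2 * d - (pre.length + 1) + 1 = 2 * d - pre.length by omega, add_comm]
    have hD' : Dacc + enc (((2 * d - (pre.length + 1) : ℕ) : ℤ) * ak) * pG ^ (2 * d - (pre.length + 1)) =
        packFromD (2 * d - (pre ++ [ak]).length) (pre ++ [ak]).reverse := by
      rw [hrev, List.length_append, List.length_singleton, packFromD, hD,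
        show 2 * d - (pre.length + 1) + 1 = 2 * d - pre.length by omega, add_comm]
    have hP : -(((pre.length + 1 : ℕ) : ℤ) * ak) + -(List.zipWith (· * ·) pre ps).sum = nodeP pre ps ak := rfl
    rw [censusSearchQ]
    dsimp only
    rw [hR, hb]
    split_ifs with hf
    · subst hf
      rw [censusSearchC] at ha
      simp only [List.length_append, List.length_singleton] at ha
      split_ifs at ha with hleaf
      · simp only [List.mem_singleton] at ha
        subst ha
        have hd1 : pre.length + 1 = d := by omega
        subst hd1
        simp only [List.mem_flatMap, mem_icc]
        refine ⟨ak, ⟨hlo, hhi⟩, ?_⟩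
        set cs := palC (pre ++ [ak]) with hcs
        have hcs' : cs = pre ++ [ak] ++ (pre.reverse ++ [1]) := by simp [hcs, palC]
        set prev := nodeP pre ps ak :: ps with hprev
        have hplen : prev.length + 1 = pre.length + 1 + 1 := by simp [hprev, hlen]
        have hts : ∀ t' ∈ T.drop (pre.length + 1), t' < 2 ^ 61 := fun t' ht' => hT t' (List.mem_of_mem_drop ht')
        have htl : pre.length + 1 + 1 + (T.drop (pre.length + 1)).length ≤ 64 := by rw [List.length_drop]; omega
        have hCf : Cacc + enc ak * pG ^ (pre.length + 1) + Hacc + pG ^ (2 * (pre.length + 1)) = (cPoly cs).eval pG := by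
          rw [eval_cPoly, hcs', packFrom_append, packFrom_append, packFrom_append, List.length_append,
            List.length_singleton, List.length_reverse, hC, hH]
          simp only [packFrom, enc_one, one_mul, add_zero]
          rw [show 2 * (pre.length + 1) - pre.length = 1 + (pre.length + 1) by omega,
            show 2 * (pre.length + 1) = 1 + (pre.length + 1) + pre.length by omega,
            show 1 + pre.length = pre.length + 1 by omega]
          ring
        have hSv : packS prev = (sPoly (sigma0 prev) (pre.length + 1 + 1)).eval pG := by
          rw [← hplen]; exact packS_eq_eval prev
        have hDv : packFromD (pre.length + 1 + 1) (pre.reverse ++ [1]) = (dPoly cs (pre.length + 1 + 1)).eval pG := by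
          rw [eval_dPoly _ _ (by omega), show pre.length + 1 + 1 - 1 = (pre ++ [ak]).length by simp, hcs', List.drop_left]
        have hfin : ∀ cf' Z' : ℕ, cf' = (cPoly cs).eval pG →
            Z' = cf' * packS prev + packFromD (pre.length + 1 + 1) (pre.reverse ++ [1]) →
            pre ++ [ak] ∈ (if leafLoopPJ cf' (1 :: cs) (2 * (pre.length + 1)) NJ (T.drop (pre.length + 1)) Z'
              (pG ^ (pre.length + 1) * pG) then [pre ++ [ak]] else []) := by
          intro cf' Z' hcf' hZ'
          have hZ'' : Z' = (cPoly cs * sPoly (sigma0 prev) (pre.length + 1 + 1) + dPoly cs (pre.length + 1 + 1)).eval pG := by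
            rw [hZ', eval_add, eval_mul, ← hcf', hSv, hDv]
          have hF : leafLoopPJ cf' (1 :: cs) (2 * (pre.length + 1)) NJ (T.drop (pre.length + 1)) Z'
              (pG ^ (pre.length + 1) * pG) = true := by
            rw [leafLoopPJ_eq_of_not_junk hj]
            exact leafLoopP_of_leafPass cs (pre.length + 1 + 1) cf' hcf' (T.drop (pre.length + 1)) prev (sigma0 prev)
              (pre.length + 1 + 1) Z' _ hplen le_rfl htl hts rfl (sigma0_lt prev)
              (fun i hi => by rw [← hplen]; exact sigma0_cast prev i hi) hZ'' (by ring) hleaf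
          rw [hF, if_pos rfl]
          exact List.mem_singleton_self _
        refine hfin _ _ hCf ?_
        rw [show 2 * (pre.length + 1) - pre.length = pre.length + 1 + 1 by omega] at hD
        rw [hprev, packS, ← hS, hlen, packFromD_append, ← hD, List.length_reverse,
          show pre.length + 1 + 1 + pre.length = 2 * (pre.length + 1) by omega]
        simp only [packFromD, add_zero, nodeP, mul_one]
        push_cast
        ring_nf
      · simp at ha
    · simp only [List.mem_flatMap, mem_icc]
      refine ⟨ak, ⟨hlo, hhi⟩, ?_⟩
      rw [hP]
      split_ifs with hchk
      · obtain ⟨hak, hPk⟩ := hchk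
        refine (ih (pre ++ [ak]) (nodeP pre ps ak :: ps) a _ _ _ _ hlen' h1' hd' hS' hC' hH' hD' ?_ ?_ ha).resolve_right
          (by rw [hj]; decide)
        · intro c hc
          rw [List.mem_append, List.mem_singleton] at hc
          rcases hc with hc | rfl
          · exact hbpre c hc
          · exact hak
        · intro p hp'
          rw [List.mem_cons] at hp'
          rcases hp' with rfl | hp'
          · exact hPk
          · exact hbps p hp'
      · exact ha

/-- **Kernel-check form**: certificates for the survivors of `censusSearchQs` certify every survivor of `censusSearchC` at a node
carrying its own power sums (bounded prefix: coefficients `≤ 2^10`, power sums `≤ 2^20`, checked by `decide` at the node). -/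
theorem forall_certX_of_allCertifiedQs {Bn Bd d : ℕ} {L : List (List ℤ)} {LC : List (List ℤ × ℤ)} {T : List ℕ}
    {CT : List (List (List ℤ × ℤ))} {QT : List (List (ℤ × ℕ × ℤ))} (hT : ∀ t ∈ T, t < 2 ^ 61) (hTl : T.length ≤ 62)
    (hdl : d ≤ 62) (hQT : QTablesOK CT QT d) {NJ fuel : ℕ} {pre : List ℤ} (h1 : 1 ≤ pre.length) (hd : pre.length + fuel = d)
    (hbpre : ∀ c ∈ pre, c.natAbs ≤ 2 ^ 10) (hbps : ∀ p ∈ psumsRev pre pre.length, p.natAbs ≤ 2 ^ 20) (certs : List CertX)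
    (h : allCertifiedX Bn Bd d L LC (censusSearchQs T CT QT d NJ fuel pre) certs = true) :
    ∀ a ∈ censusSearchC T CT fuel pre (psumsRev pre pre.length), ∃ c, checkCertX Bn Bd d L LC (1 :: palC a) c = true := by
  intro a ha
  rcases mem_censusSearchQ_or_junk (NJ := NJ) hT hTl hdl hQT fuel pre _ a _ _ _ _ (length_psumsRev _ _) h1 hd rfl rfl rfl rfl
    hbpre hbps ha with hP | hj
  · exact exists_certX_of_allCertifiedX _ certs h a hP
  · exact exists_certX_of_junkK hj

end Summit.Ventures.DiscreteObjects.Mahler
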